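import Summits.BirchSwinnertonDyer.BirchSwinnertonDyer.Theorems.CumulativeHeegnerLeopoldtEisensteinCharacterInvariantsAtThreeCurveRelaxationCount
import Summits.BirchSwinnertonDyer.BirchSwinnertonDyer.Theorems.CumulativeHeegnerLeopoldtEisensteinCharacterInvariantsAtThreeCurveRelaxationLocSurj
import Summits.BirchSwinnertonDyer.BirchSwinnertonDyer.Theorems.CumulativeHeegnerLeopoldtEisensteinCharacterInvariantsAtThreeAlgSplit
import Literature.NumberTheory.GaloisRepresentations.LocalEulerPoincareCharacteristicProofs
import Literature.NumberTheory.IwasawaTheory.Greenberg2006.LocalH2VanishingOfLOC1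
import HarnessLib

/-!
# Route `CumulativeHeegnerLeopoldt`, crux K2-odd `EisensteinCharacterInvariantsAtThreeOdd` (stmt-23970), line `birth` v8:
# STUB ALG-≥(i) `stub_curveRelaxationCorankEq` PROVED — the relaxation count
# `corank_{ℤ_3}(Sel_{𝔭′}^{Sf′}/Sel_{𝔭′}^∅)(E_K) = Σ_{w∈Sf′} [Γ:Γ_w] · corank_{ℤ_3} H¹(K_{∞,w}, E[3^∞])` on the Leopoldt cell,
# GRANTED CGLS Prop. 14, Greenberg 2016 Prop. 2.6.3, Greenberg 2006 Props. 4.1, 3.2 BY NAME (the stub's antecedents)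

Lead prover `bsd-line-chl-p1` g10 (`--supports stmt-BirchSwinnertonDyer-23970`; registered stub of skeleton v8 VERBATIM). Composition:
`X_{∅,0}(𝔭′)` finitely generated `Λ`-torsion from CGLS Prop. 14 through B1 (g9: `…B1OfPrint`, `…AlgebraicHalf`, as in
`EisensteinCharacterInvariantsAtThreeAlgSplit`) ⟹ SUR(`𝐃_E`, `𝓛_𝔭`) and the `K_∞`-side surjectivity at the tame bad places
(`CurveRelaxationLocSurj.curve_exists_forall_resOfLe_conjH1_pow_eq_tame`, Greenberg 2006 Prop. 4.2 and §5 A fed as the tree theorems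
`prop42_localEulerPoincareCorank_holds`, `sec5A_localH2_subsingleton_of_LOC1_holds`) ⟹ the count
(`CurveRelaxationCount.zpCorank_selmerAc_quotient_eq_sum_of_forall_exists`; finite decomposition at `Sf′` by Brink under (Heeg)).
CONDITIONAL on the four named facts (its displayed hypotheses); no definition, no named fact introduced, no `sorry`. With STUB ALG-≥(ii)
(the local lower bound) it yields [ALG-λ]. BSD is not proved for any curve by any of this.
References: [PollackWeston2011] App. A Prop. A.2; [GreenbergVatsal2000] §2 Cor. (2.3); [CastellaGrossiLeeSkinner2022] §1.4 (eq:1), Prop. 14;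
[Greenberg2016Selmer] Prop. 2.6.3; [Greenberg2006] Props. 3.2, 4.1, 4.2, §5 A; [Brink2007] Thm. 2.
-/

set_option autoImplicit false
-- `…BirchSwinnertonDyer.BirchSwinnertonDyer.Theorems…` is the problem's mandated namespace (D-0017).
set_option linter.dupNamespace false

noncomputable section

open scoped Classical

open WeierstrassCurve NumberField IsDedekindDomain Field Multiplicative
  Literature.NumberTheory.EllipticCurves Literature.NumberTheory.EllipticCurves.GreenbergSelmer
  Literature.NumberTheory.GaloisRepresentations Literature.NumberTheory.EllipticCurves.KellerYin2024
  Literature.NumberTheory.EllipticCurves.Rank1Residual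
  Literature.NumberTheory.IwasawaTheory Literature.NumberTheory.IwasawaTheory.Greenberg2016
  Literature.NumberTheory.IwasawaTheory.Greenberg2006
  Summit.BirchSwinnertonDyer.BirchSwinnertonDyer.Theorems

namespace Summit.BirchSwinnertonDyer.BirchSwinnertonDyer.Theorems.EisensteinCharacterInvariantsAtThreeCurveRelaxation

/-- **STUB ALG-≥(i) of line `birth` v8 (registered signature VERBATIM):** on the Leopoldt cell, for every `Sf′` = the places of `K`
over `N` prime to `3`, `corank_{ℤ_3}(Sel_{𝔭′}^{Sf′}(K_∞, E[3^∞]) / Sel_{𝔭′}^∅(K_∞, E[3^∞])) = Σ_{w∈Sf′} [Γ:Γ_w] · corank_{ℤ_3} H¹(ker κ ⊓ D_w, E[3^∞])`,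
granted CGLS Prop. 14, Greenberg 2016 Prop. 2.6.3 and Greenberg 2006 Props. 4.1, 3.2 by name. CONDITIONAL; with ALG-≥(ii) gives [ALG-λ].
[cite: PollackWeston2011, App. A Prop. A.2] [cite: GreenbergVatsal2000, §2 Cor. (2.3), Prop. (2.4)]
[cite: CastellaGrossiLeeSkinner2022, §1.2 Prop. 14 and §1.4 (eq:1)] [cite: Greenberg2016Selmer, Prop. 2.6.3] [cite: Greenberg2006, Props. 3.2, 4.1, 4.2, §5 A] -/
theorem stub_curveRelaxationCorankEq :
    Literature.NumberTheory.EllipticCurves.CastellaGrossiLeeSkinner2022.prop14_residualCharacterSelmer_finite → Literature.NumberTheory.IwasawaTheory.Greenberg2016.prop263_sur_of_crk → Literature.NumberTheory.IwasawaTheory.Greenberg2006.prop41_globalEulerPoincareCorank → Literature.NumberTheory.IwasawaTheory.Greenberg2006.prop32_cohomology_isCofinitelyGenerated →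
    ∀ (W : WeierstrassCurve ℚ) [W.IsElliptic] [W.IsGloballyMinimal] (N : ℕ) [NeZero N] (K : Type) [Field K] [NumberField K], Summit.BirchSwinnertonDyer.Rank1Residual.Additive.ClassO6 W 3 → Literature.NumberTheory.EllipticCurves.Rank1Residual.Red W 3 → (∃ Φ : AddSubgroup (WeierstrassCurve.geomTorsion W ((3 : ℕ) : ℤ)), Literature.NumberTheory.EllipticCurves.Rank1Residual.IsRationalLine W 3 Φ ∧ ∀ (v : IsDedekindDomain.HeightOneSpectrum (NumberField.RingOfIntegers ℚ)), ((3 : ℕ) : NumberField.RingOfIntegers ℚ) ∈ v.asIdeal → ∀ 𝔓 ∈ v.primesAbove, ¬ (∀ g ∈ 𝔓.decompositionSubgroup (Field.absoluteGaloisGroup ℚ), ∀ P ∈ Φ, g • P = P) ∧ ¬ (∀ g ∈ 𝔓.decompositionSubgroup (Field.absoluteGaloisGroup ℚ), ∀ P : WeierstrassCurve.geomTorsion W ((3 : ℕ) : ℤ), g • P - P ∈ Φ)) → W.conductorNorm ℤ = N → Literature.NumberTheory.EllipticCurves.IsImaginaryQuadratic K → Literature.NumberTheory.EllipticCurves.SatisfiesHeegnerHypothesis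 N K → Odd (NumberField.discr K) → (∀ Q : (W.baseChange K).toAffine.Point, (3 : ℕ) • Q = 0 → Q = 0) → ∀ (κ : Literature.NumberTheory.EllipticCurves.ZpExtension K 3), κ.IsAnticyclotomic → ∀ (γ : Field.absoluteGaloisGroup K) [Fact (κ.IsTopGenerator γ)] (𝔭 : IsDedekindDomain.HeightOneSpectrum (NumberField.RingOfIntegers K)), ((3 : ℕ) : NumberField.RingOfIntegers K) ∈ 𝔭.asIdeal → 𝔭.asIdeal.ramificationIdx (NumberField.RingOfIntegers ℚ) = 1 → 𝔭.asIdeal.inertiaDeg (NumberField.RingOfIntegers ℚ) = 1 → ∀ (𝔭' : IsDedekindDomain.HeightOneSpectrum (NumberField.RingOfIntegers K)), ((3 : ℕ) : NumberField.RingOfIntegers K) ∈ 𝔭'.asIdeal → 𝔭' ≠ 𝔭 → ∀ (Sf' : Finset (IsDedekindDomain.HeightOneSpectrum (NumberField.RingOfIntegers K))), (∀ w : IsDedekindDomain.HeightOneSpectrum (NumberField.RingOfIntegers K), w ∈ Sf' ↔ (((W.conductorNorm ℤ : ℤ) : NumberField.RingOfIntegers K) ∈ w.asIdeal ∧ ((3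 : ℕ) : NumberField.RingOfIntegers K) ∉ w.asIdeal)) → Literature.NumberTheory.EllipticCurves.zpCorank (↥(Summit.BirchSwinnertonDyer.Rank1Residual.X11b.AcSelmer.selmerAc (W.baseChange K) 3 κ 𝔭' (↑Sf' : Set (IsDedekindDomain.HeightOneSpectrum (NumberField.RingOfIntegers K)))) ⧸ (Summit.BirchSwinnertonDyer.Rank1Residual.X11b.AcSelmer.selmerAc (W.baseChange K) 3 κ 𝔭' (∅ : Set (IsDedekindDomain.HeightOneSpectrum (NumberField.RingOfIntegers K)))).addSubgroupOf (Summit.BirchSwinnertonDyer.Rank1Residual.X11b.AcSelmer.selmerAc (W.baseChange K) 3 κ 𝔭' (↑Sf' : Set (IsDedekindDomain.HeightOneSpectrum (NumberField.RingOfIntegers K))))) 3 = ∑ w ∈ Sf', Literature.NumberTheory.EllipticCurves.KellerYin2024.numPlacesAbove κ w * Literature.NumberTheory.EllipticCurves.zpCorank (Literature.NumberTheory.EllipticCurves.subgroupH1 (κ.kerSubgroup ⊓ Literature.NumberTheory.EllipticCurves.GreenbergSelmer.decomp w) ((W.baseChange K).geomPrimaryTorsion 3)) 3 := by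
  intro hP h263 h41 h32 W _ _ N _ K _ _ hO6 hRed hcell hN hK hHN hodd hEK κ hκ γ hγI 𝔭 h𝔭 he hf 𝔭' h𝔭' hne Sf' hSf'
  haveI : Fact (Nat.Prime 3) := ⟨Nat.prime_three⟩
  haveI hEKi : (W.baseChange K).IsElliptic := inferInstanceAs (W.map (algebraMap ℚ K)).IsElliptic
  -- `X_{∅,0}(𝔭′)` is finitely generated `Λ`-torsion, from print (CGLS Prop. 14 ⟹ B1 ⟹ Greenberg's criterion)
  have hfin := CumulativeHeegnerInclusionAtThreeB1OfPrint.stub_residualSelmerFinite_of_print hP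
    CumulativeHeegnerInclusionAtThreeLineDet.stub_lineDeterminantAtThree
    CumulativeHeegnerInclusionAtThreeBadPlaces.stub_badPlacesSplitFinite W N K hO6 hRed hcell hN hK hHN κ hκ 𝔭' h𝔭'
  obtain ⟨hT, -⟩ :=
    EisensteinCharacterInvariantsAtThreeAlgebraicHalf.isTorsion_and_muInvariant_eq_zero_of_residualFinite W K κ γ 𝔭' hfin
  have hXfin := Summit.BirchSwinnertonDyer.Rank1Residual.X11b.AcSelmer.XAc.module_finite κ 𝔭'
    (∅ : Set (HeightOneSpectrum (𝓞 K))) γ Set.finite_empty (W := W.baseChange K)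
  subst hN
  -- the `K_∞`-side surjectivity at the tame bad places (Greenberg 2006 Prop. 4.2 and §5 A are tree theorems)
  obtain ⟨a, hdiv, hd₀, hsurj⟩ := CurveRelaxationLocSurj.curve_exists_forall_resOfLe_conjH1_pow_eq_tame h263 h41
    LocalEulerPoincareCorank.prop42_localEulerPoincareCorank_holds sec5A_localH2_subsingleton_of_LOC1_holds h32 W
    (by norm_num) hK hHN h𝔭 h𝔭' hne κ hκ γ Sf' hSf' hXfin hT
  -- finite decomposition at `Sf′` (Brink, under (Heeg)) and the count
  have hSfdec : ∀ w ∈ Sf', ∃ δ ∈ decomp (K := K) w, κ δ ≠ 1 := fun w hw ↦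
    UnrSelmerQuotientTorsionFiniteChar.exists_mem_decomp_apply_ne_one_of_heegner hK (by norm_num) hHN κ hκ w
      ((hSf' w).mp hw).1 ((hSf' w).mp hw).2
  exact CurveRelaxationCount.zpCorank_selmerAc_quotient_eq_sum_of_forall_exists κ (W.baseChange K) 𝔭' Sf' hγI.out
    (fun w hw ↦ ((hSf' w).mp hw).2) hSfdec a hdiv hd₀ (fun _ i ↦ γ ^ i)
    (fun _ _ i _ ↦ UnrSelmerNaturalLocalization.toAdd_apply_pow_of_isTopGenerator κ hγI.out i) hsurj

end Summit.BirchSwinnertonDyer.BirchSwinnertonDyer.Theorems.EisensteinCharacterInvariantsAtThreeCurveRelaxation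

end
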